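import Summits.BirchSwinnertonDyer.BirchSwinnertonDyer.Theorems.ByReductionTypeAtTwoOrdKatoHalfAtTwoIsoQTermTranspositionFamily
import Summits.BirchSwinnertonDyer.BirchSwinnertonDyer.Theorems.ByReductionTypeAtTwoOrdKatoHalfAtTwoIsoTransversePerfectPrimePow
import Summits.BirchSwinnertonDyer.BirchSwinnertonDyer.Theorems.SmallImageMuTransferMuTransferX9StepsTwoFourAssembly
import HarnessLib

/-!
# Crux `OrdKatoHalfAtTwoIso` (stmt-BirchSwinnertonDyer-19573), line `steinberg-fibre-at-two` (v5): helper W4b,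
# file 3/3 — THE `q`-TERM IDENTITY AT A TRANSPOSITION PRIME (`p = 2`), unit leading coefficient, for EVERY
# global cocycle `c` of `W.modPTwist 2 κ J` and every `Ψc` unramified at `q`

HONEST FRAMING (cell bsd-2adic): BSD is not proved; the crux is NOT proved; no registered stub is proved here;
nothing is booked.  KERNEL HELPER (`--supports … --as helper`) = interior step M3 (K4-local) of the registered
stub `stub_HK_kolyvaginRankOneTwo` (Ω road; credit: scrit STUB-PLAN F4/K4, sidea-stub_port-2 card #9, W3d's H-P).
REPLACES, at `p = 2`, the odd core's `E`-split `…X9LocalQTerm{,Naturality,Adapter}` (exact depth, transverse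
Kolyvagin class, `p ≠ 2`).  TOOL theorems only (no definition, no named fact, no `sorry`); nothing asserted.
* `LocalSplitPrime.exists_unramified_cupProduct_ne_zero_of_transverse_primePow` — the odd core's `tr × ur`
  non-degeneracy WITHOUT `p ≠ 2` (generic `K`, `p`): the `tr ⊥ tr` step is replaced by W3d's
  `eq_zero_of_mem_transverse_of_forall_unramified_pairing_eq_zero_primePow` (`ur^⊥ ⊆ ur` + `ur ⊓ tr = ⊥`).
* `exists_unit_inv_cupProduct_eq_sum_convCoeff_transposition` — file 2's identity with `u_0 ≠ 0` (else the
  non-zero transverse class `S^{J−1} X(δ_0 Q) = X(δ_{J−1} P₀)` would pair to zero with every unramified class).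
* `exists_unit_qTermIdentity_transposition` — the ADAPTER to the local classes `loc_q[c]`, `loc_q(T^ε[Ψc])` of
  GLOBAL cocycles (x10's cocycle seams), in the verbatim shape of the `hQ` hypothesis of STEP 4
  (`StepFour.convCoeff_eq_zero_of_qTermIdentity_modPTwist`), with NO transversality premise on `c`.

References: B. Mazur, K. Rubin, Mem. AMS 799 (2004) §1.2, Prop. 1.3.2 [MazurRubin2004]; K. Rubin, *Euler
Systems* (2000) Lemma 1.4.7, Thm. 4.5.4 [Rubin2000]; J. S. Milne, *ADT* (2006) I Cor. 2.3, Thm. 2.6 [MilneADT2006].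
-/
set_option autoImplicit false
set_option linter.dupNamespace false

noncomputable section

open scoped Classical ContRepresentation
open CategoryTheory ContinuousCohomology Function Field ValuativeRel NumberField IsDedekindDomain Finset
open WeierstrassCurve
open Literature.NumberTheory.GaloisRepresentations
open Literature.NumberTheory.GaloisRepresentations.IsNonarchimedeanLocalField
open _root_.TopRep
open Literature.NumberTheory.GaloisCohomology
open Literature.NumberTheory.EllipticCurves
open Summit.BirchSwinnertonDyer.Rank1Residual.GaloisImage
open Summit.BirchSwinnertonDyer.Rank1Residual (X11b.LocBridge.mem_unramifiedSubgroup_one_iff_forall_eq_zero)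
open Summit.BirchSwinnertonDyer.BirchSwinnertonDyer.Rank1Residual
open Summit.BirchSwinnertonDyer.BirchSwinnertonDyer.Rank1Residual.LocalSplitPrime

universe u

/-! ## §1 `tr × ur` non-degeneracy in the twist/Gorenstein currency at a PRIME POWER (no `p ≠ 2`) -/

namespace Summit.BirchSwinnertonDyer.BirchSwinnertonDyer.Rank1Residual.LocalSplitPrime

section Perfect

variable {K : Type u} [Field K] [NumberField K] {p : ℕ} [Fact p.Prime]
  {M M' : Type u} [AddCommGroup M] [TopologicalSpace M] [DiscreteTopology M] [Finite M]
  [AddCommGroup M'] [TopologicalSpace M'] [DiscreteTopology M'] [Finite M']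
  (ρ : DiscreteGaloisModule K M) (ρ' : DiscreteGaloisModule K M')
  (hM : ∀ x : M, p • x = 0) (hM' : ∀ x : M', p • x = 0) (κ : ZpExtension K p) (J : ℕ)
  (q : HeightOneSpectrum (𝓞 K)) [Fact (Ideal.absNorm q.asIdeal).Prime]
  [NeZero ((Ideal.absNorm q.asIdeal : ℕ) : q.adicCompletion K)]
  -- cup products on `Γ_{K_q}` need `LocallyCompactSpace` (a `Prop`): an instance binder, as in the odd files
  [LocallyCompactSpace (absoluteGaloisGroup (q.adicCompletion K))]

omit [Finite M'] in
-- adapted from `…X9LocalQTermNaturality.exists_unramified_cupProduct_ne_zero_of_transverse` (odd twin, verbatim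
-- up to the final step): `tr ⊥ tr` (odd `p`) is replaced by W3d's prime-power perfectness
/-- **`tr × ur` perfectness in the twist/`B`-currency at ANY prime `p`** (`p = 2` included): a NON-ZERO transverse
class of `𝒯_J|_q` pairs non-trivially, through any local pairing `P` with bilinear map the Gorenstein pairing of a
perfect `e`, with some UNRAMIFIED cocycle of `𝒯′_J|_q` (`ur^⊥ ⊆ ur` by counting at prime-power level, `ur ⊓ tr = ⊥`).
[cite: MazurRubin2004, Prop. 1.3.2 (p. 12)] [cite: MilneADT2006, Ch. I, Cor. 2.3 and Thm. 2.6] -/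
theorem exists_unramified_cupProduct_ne_zero_of_transverse_primePow
    {e : M →+ M' →+ DiscreteGaloisModule.MuCarrier K p}
    (he : ∀ (g : absoluteGaloisGroup K) (a : M) (b : M'),
      e (ρ g a) (ρ' g b) = DiscreteGaloisModule.mu K p g (e a b))
    (hnd : ∀ b : M', (∀ a : M, e a b = 0) → b = 0)
    (hsurj : ∀ χ : M →+ DiscreteGaloisModule.MuCarrier K p, ∃ b : M', ∀ a, e a b = χ a)
    (hunr : GaloisRep.IsUnramifiedAt q ρ) (hunr' : GaloisRep.IsUnramifiedAt q ρ')
    (hqp : (p : 𝓞 K) ∉ q.asIdeal)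
    (hχI : ∀ u : (ZMod (Ideal.absNorm q.asIdeal))ˣ, ∃ t ∈ absInertia (q.adicCompletion K),
      modPCyclotomicCharacterZMod (q.adicCompletion K) (Ideal.absNorm q.asIdeal) t = u)
    (inv : LocalInvariants K p) (hperf : inv.IsPerfect)
    (P : ContPairing (GaloisRep.toLocal q (κ.twistModP ρ hM J)).toTopRep
      (GaloisRep.toLocal q (κ.invTwist.twistModP ρ' hM' J)).toTopRep
      ((DiscreteGaloisModule.mu K p).toLocal (Sum.inr q)).toTopRep)
    (hP : ∀ x y, P.toLin x y = gorensteinPairing e J x y)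
    {c : galoisCohomology (GaloisRep.toLocal q (κ.twistModP ρ hM J)) 1}
    (hc : c ∈ DiscreteGaloisModule.transverseSubgroup (GaloisRep.toLocal q (κ.twistModP ρ hM J))
      (CyclotomicField (Ideal.absNorm q.asIdeal) (q.adicCompletion K)))
    (hc0 : c ≠ 0) :
    ∃ ψ : contOneCocycles (GaloisRep.toLocal q (κ.invTwist.twistModP ρ' hM' J)).toTopRep,
      (∀ t ∈ absInertia (q.adicCompletion K), ψ.1 t = 0) ∧
        inv (Sum.inr q) (P.cupProduct c (oneCocycleClass _ ψ)) ≠ 0 := by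
  classical
  by_contra hcon
  have hcon' : ∀ ψ : contOneCocycles (GaloisRep.toLocal q (κ.invTwist.twistModP ρ' hM' J)).toTopRep,
      (∀ t ∈ absInertia (q.adicCompletion K), ψ.1 t = 0) →
        inv (Sum.inr q) (P.cupProduct c (oneCocycleClass _ ψ)) = 0 :=
    fun ψ hψ => by by_contra h; exact hcon ⟨ψ, hψ, h⟩
  haveI : NeZero p := ⟨(Fact.out : p.Prime).ne_zero⟩
  have hI : ∀ t ∈ absInertia (q.adicCompletion K), ∀ x : Fin J → M,
      GaloisRep.toLocal q (κ.twistModP ρ hM J) t x = x :=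
    fun _ ht x => toLocal_twistModP_apply_of_mem_absInertia ρ hM κ J q hunr hqp ht x
  have hI' : ∀ t ∈ absInertia (q.adicCompletion K), ∀ y : Fin J → M',
      GaloisRep.toLocal q (κ.invTwist.twistModP ρ' hM' J) t y = y :=
    fun _ ht y => toLocal_twistModP_apply_of_mem_absInertia ρ' hM' κ.invTwist J q hunr' hqp ht y
  -- `D = twistDualMap` on the local modules, and its inverse
  have hDgeq : ∀ (g : absoluteGaloisGroup (q.adicCompletion K)) (y : Fin J → M'),
      κ.twistDualMap ρ ρ' p hM hM' J he (GaloisRep.toLocal q (κ.invTwist.twistModP ρ' hM' J) g y) =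
        GaloisRep.toLocal q ((κ.twistModP ρ hM J).tateDual p) g (κ.twistDualMap ρ ρ' p hM hM' J he y) :=
    fun g y => ContinuousLinearMap.ext_iff.1
      ((κ.twistDualMap ρ ρ' p hM hM' J he).isIntertwining' (absGaloisRestrict K (q.adicCompletion K) g)) y
  obtain ⟨Dl, hDlg⟩ := exists_contIntertwiningMap_of_comm
    (GaloisRep.toLocal q (κ.invTwist.twistModP ρ' hM' J)) (GaloisRep.toLocal q ((κ.twistModP ρ hM J).tateDual p))
    (κ.twistDualMap ρ ρ' p hM hM' J he).toContinuousLinearMap.toLinearMap.toAddMonoidHom (fun g y => hDgeq g y)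
  have hDl : ∀ y x, Dl y x = gorensteinPairing e J x y := fun y x => by rw [hDlg]; rfl
  have hinjD : Function.Injective (fun y => Dl y) := fun y y' hy =>
    κ.twistDualMap_injective ρ ρ' p hM hM' J he hnd ((hDlg y).symm.trans (hy.trans (hDlg y')))
  have hsurjD : Function.Surjective (fun y => Dl y) := fun z => by
    obtain ⟨y, hy⟩ := κ.twistDualMap_surjective ρ ρ' p hM hM' J he hsurj z
    exact ⟨y, (hDlg y).trans hy⟩
  have hDeq : ∀ (g : absoluteGaloisGroup (q.adicCompletion K)) (y : Fin J → M'),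
      Dl (GaloisRep.toLocal q (κ.invTwist.twistModP ρ' hM' J) g y) =
        GaloisRep.toLocal q ((κ.twistModP ρ hM J).tateDual p) g (Dl y) := fun g y => by
    rw [hDlg, hDlg]; exact hDgeq g y
  choose ginv hginv using hsurjD
  have hginv_add : ∀ z z', ginv (z + z') = ginv z + ginv z' := fun z z' =>
    hinjD (by simp only [hginv, map_add])
  obtain ⟨Dinv, hDinv⟩ := exists_contIntertwiningMap_of_comm
    (GaloisRep.toLocal q ((κ.twistModP ρ hM J).tateDual p)) (GaloisRep.toLocal q (κ.invTwist.twistModP ρ' hM' J))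
    (AddMonoidHom.mk' ginv hginv_add) (fun g z => hinjD (by
      simp only [AddMonoidHom.mk'_apply, hDeq, hginv]))
  have hDD : ∀ z, Dl (Dinv z) = z := fun z => by rw [hDinv]; exact hginv z
  -- the evaluation pairing of the local modules, retyped on the `GaloisRep.toLocal` side
  obtain ⟨P₁, hP₁, hP₁lin⟩ : ∃ P₁ : ContPairing (GaloisRep.toLocal q (κ.twistModP ρ hM J)).toTopRep
      (GaloisRep.toLocal q ((κ.twistModP ρ hM J).tateDual p)).toTopRep
      ((DiscreteGaloisModule.mu K p).toLocal (Sum.inr q)).toTopRep,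
      (∀ a b, DiscreteGaloisModule.localTatePairingZMod (κ.twistModP ρ hM J) p (Sum.inr q) (inv (Sum.inr q)) a b =
        inv (Sum.inr q) (P₁.cupProduct a b)) ∧ ∀ x f, P₁.toLin x f = f x :=
    ⟨DiscreteGaloisModule.tateDualPairingLocal (κ.twistModP ρ hM J) p (Sum.inr q), fun _ _ => rfl, fun _ _ => rfl⟩
  -- the local Tate pairing of `(a, D_* c')` is the `P`-cup product of `(a, c')`
  have hbridge : ∀ c' : galoisCohomology (GaloisRep.toLocal q (κ.invTwist.twistModP ρ' hM' J)) 1,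
      DiscreteGaloisModule.localTatePairingZMod (κ.twistModP ρ hM J) p (Sum.inr q) (inv (Sum.inr q)) c
        (galoisCohomology.map Dl 1 c') = inv (Sum.inr q) (P.cupProduct c c') := by
    intro c'
    rw [hP₁]
    refine congrArg (inv (Sum.inr q)) ?_
    have h := ContPairing.cupProduct_adjoint P₁ P (𝟙 _)
      (TopRep.ofHom ⟨Dl.toContinuousLinearMap, Dl.isIntertwining'⟩)
      (fun x y => by
        change P.toLin x y = P₁.toLin x (Dl y)
        rw [hP, hP₁lin, hDl]) c c'
    have h1' : (cohomologyMap (𝟙 (GaloisRep.toLocal q (κ.twistModP ρ hM J)).toTopRep) 1) c = c := by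
      rw [show cohomologyMap (𝟙 (GaloisRep.toLocal q (κ.twistModP ρ hM J)).toTopRep) 1 = 𝟙 _ from
        map_id_eq_id _ (fun _ => rfl) 1]
      rfl
    rw [h1'] at h
    exact h.symm
  -- every unramified class of the Tate dual pairs to zero with `c`
  have h0 : ∀ b ∈ DiscreteGaloisModule.unramifiedSubgroup (GaloisRep.toLocal q ((κ.twistModP ρ hM J).tateDual p)) 1,
      DiscreteGaloisModule.localTatePairingZMod (κ.twistModP ρ hM J) p (Sum.inr q) (inv (Sum.inr q)) c b = 0 := by
    intro b hb
    have hc'ur : galoisCohomology.map Dinv 1 b ∈ DiscreteGaloisModule.unramifiedSubgroup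
        (GaloisRep.toLocal q (κ.invTwist.twistModP ρ' hM' J)) 1 := map_mem_unramifiedSubgroup' _ _ Dinv hb
    have hbc : b = galoisCohomology.map Dl 1 (galoisCohomology.map Dinv 1 b) :=
      (map_map_eq_self_of_leftInverse _ _ Dl Dinv hDD b).symm
    obtain ⟨ψ', hψ'⟩ := oneCocycleClass_surjective _ (galoisCohomology.map Dinv 1 b)
    have hψ'0 : ∀ t ∈ absInertia (q.adicCompletion K), ψ'.1 t = 0 :=
      (X11b.LocBridge.mem_unramifiedSubgroup_one_iff_forall_eq_zero _ hI' ψ').1 (by rw [hψ']; exact hc'ur)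
    rw [hbc, hbridge, ← hψ']
    exact hcon' ψ' hψ'0
  have hMn : ∀ x : Fin J → M, p • x = 0 := fun x => funext fun i => by rw [Pi.smul_apply, hM, Pi.zero_apply]
  exact hc0 (Summit.BirchSwinnertonDyer.BirchSwinnertonDyer.Theorems.SteinbergFibreAtTwo.eq_zero_of_mem_transverse_of_forall_unramified_pairing_eq_zero_primePow
    (κ.twistModP ρ hM J) inv q (Ideal.absNorm q.asIdeal) (Fact.out : p.Prime).isPrimePow hperf hMn hqp hI hχI hc h0)

end Perfect

end Summit.BirchSwinnertonDyer.BirchSwinnertonDyer.Rank1Residual.LocalSplitPrime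

namespace Summit.BirchSwinnertonDyer.BirchSwinnertonDyer.Theorems.SteinbergFibreAtTwo

/-! ## §2 The unit property `u_0 ≠ 0` (`E/ℚ`, `p = 2`, transposition prime) -/
section Transposition

variable (W : WeierstrassCurve ℚ) [W.IsElliptic] (κ : ZpExtension ℚ 2) (J : ℕ)
  (eW : geomTorsion W (2 : ℤ) → geomTorsion W (2 : ℤ) → AlgebraicClosure ℚ)
  (hμ : ∀ S T, eW S T ^ 2 = 1) (hadd₁ : ∀ S₁ S₂ T, eW (S₁ + S₂) T = eW S₁ T * eW S₂ T)
  (hadd₂ : ∀ S T₁ T₂, eW S (T₁ + T₂) = eW S T₁ * eW S T₂)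
  (q : HeightOneSpectrum (𝓞 ℚ)) [Fact (Ideal.absNorm q.asIdeal).Prime]
  [NeZero ((Ideal.absNorm q.asIdeal : ℕ) : q.adicCompletion ℚ)]
  [LocallyCompactSpace (absoluteGaloisGroup (q.adicCompletion ℚ))]

-- local notation: `E[2]`, the twist `𝒯_J(E, κ)` (= `W.modPTwist 2 κ J` by `rfl`) and the dual twist `𝒯_J(E, κ⁻¹)`
local notation3 "𝓔" => geomTorsion W (2 : ℤ)
local notation3 "𝓣" => ZpExtension.twistModP κ (WeierstrassCurve.torsionGaloisModule W (2 : ℤ))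
  (fun P : geomTorsion W (2 : ℤ) => AddSubgroup.torsionBy.nsmul P) J
local notation3 "𝓓" => ZpExtension.twistModP (ZpExtension.invTwist κ) (WeierstrassCurve.torsionGaloisModule W (2 : ℤ))
  (fun P : geomTorsion W (2 : ℤ) => AddSubgroup.torsionBy.nsmul P) J

set_option maxHeartbeats 400000 in
/-- **The `q`-term identity at a transposition prime with a UNIT leading coefficient** (`u_0 ≠ 0`): file 2's
identity + `tr × ur` perfectness at the prime power `2` (`exists_unramified_cupProduct_ne_zero_of_transverse_primePow`):
if `u_0 = 0` the non-zero transverse class `S^{J−1} X(δ_0 Q) = X(δ_{J−1} P₀)` would pair to zero with every unramified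
class.  Needs the equivariance clause `hgal` of the Weil pairing (for the dual map `twistDualMap`).
[cite: MazurRubin2004, Prop. 1.3.2 (p. 12)] [cite: MilneADT2006, Ch. I, Thm. 2.6] [cite: Rubin2000, Thm. 4.5.4] -/
theorem exists_unit_inv_cupProduct_eq_sum_convCoeff_transposition
    (halt : ∀ T, eW T T = 1) (hnondeg : ∀ T, (∀ S, eW S T = 1) → T = 0)
    (hgal : ∀ (σ : absoluteGaloisGroup ℚ) (S T : 𝓔), σ • eW S T = eW (σ • S) (σ • T))
    (ι : DiscreteGaloisModule.MuCarrier ℚ 2 →+ ZMod 2) (hι : Function.Injective ι)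
    (hunr : GaloisRep.IsUnramifiedAt q (W.torsionGaloisModule (2 : ℤ)))
    (hqp : ((2 : ℕ) : 𝓞 ℚ) ∉ q.asIdeal) (hpl : 2 ∣ Ideal.absNorm q.asIdeal - 1)
    (hχI : ∀ u : (ZMod (Ideal.absNorm q.asIdeal))ˣ, ∃ t ∈ absInertia (q.adicCompletion ℚ),
      modPCyclotomicCharacterZMod (q.adicCompletion ℚ) (Ideal.absNorm q.asIdeal) t = u)
    {Fr : absoluteGaloisGroup (q.adicCompletion ℚ)} (hFr : IsAbsArithFrob Fr)
    (hT1 : galoisRepTorsion W 2 (absGaloisRestrict ℚ (q.adicCompletion ℚ) Fr) ≠ 1)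
    (hT2 : galoisRepTorsion W 2
      (absGaloisRestrict ℚ (q.adicCompletion ℚ) Fr * absGaloisRestrict ℚ (q.adicCompletion ℚ) Fr) = 1)
    {m : ℕ} (hJm : J ≤ 2 ^ m) (hFrm : absGaloisRestrict ℚ (q.adicCompletion ℚ) Fr ∈ κ.layerSubgroup m)
    {t₀ : absoluteGaloisGroup (q.adicCompletion ℚ)} (ht₀ : t₀ ∈ absInertia (q.adicCompletion ℚ))
    (hgen : ∀ u : (ZMod (Ideal.absNorm q.asIdeal))ˣ,
      u ∈ Subgroup.zpowers (modPCyclotomicCharacterZMod (q.adicCompletion ℚ) (Ideal.absNorm q.asIdeal) t₀))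
    (inv : LocalInvariants ℚ 2) (hperf : inv.IsPerfect)
    (P : ContPairing (GaloisRep.toLocal q 𝓣).toTopRep (GaloisRep.toLocal q 𝓓).toTopRep
      ((DiscreteGaloisModule.mu ℚ 2).toLocal (Sum.inr q)).toTopRep)
    (hP : ∀ x y, P.toLin x y = gorensteinPairing (weilPairingHom W 2 eW hμ hadd₁ hadd₂) J x y)
    (S : (GaloisRep.toLocal q 𝓣).toContRepresentation →ⁱL (GaloisRep.toLocal q 𝓣).toContRepresentation)
    (hS : ∀ x, S x = shiftEnd 𝓔 J x) :
    ∃ u : ℕ → ZMod 2, u 0 ≠ 0 ∧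
      ∀ k < J, ∀ (φ : contOneCocycles (GaloisRep.toLocal q 𝓣).toTopRep)
        (ψ : contOneCocycles (GaloisRep.toLocal q 𝓓).toTopRep),
        (∀ t ∈ absInertia (q.adicCompletion ℚ), ψ.1 t = 0) →
        inv (Sum.inr q) (P.cupProduct
            ((galoisCohomology.map S 1)^[J - 1 - k] (oneCocycleClass _ φ)) (oneCocycleClass _ ψ)) =
          ∑ j ∈ Finset.range (k + 1), u j *
            ι (convCoeff (weilPairingHom W 2 eW hμ hadd₁ hadd₂) J (k - j) (φ.1 t₀) (ψ.1 Fr)) := by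
  classical
  rcases Nat.eq_zero_or_pos J with hJ0 | hJ
  · exact ⟨fun _ => 1, one_ne_zero, fun k hk => absurd hk (by omega)⟩
  haveI : Finite 𝓔 := finite_geomTorsion_of_neZero W 2
  obtain ⟨u, hu⟩ := exists_inv_cupProduct_eq_sum_convCoeff_transposition W κ J eW hμ hadd₁ hadd₂ q halt
    hnondeg ι hι hunr hqp hpl hχI hFr hT1 hT2 hJm hFrm ht₀ hgen inv P hP S hS
  refine ⟨u, fun hu0 => ?_, hu⟩
  -- PERFECTNESS: if `u_0 = 0`, the transverse class `S^{J−1}[φ]`, `φ(t₀) = δ_0 P₀`, is `≠ 0` but pairs to zero with ur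
  have hI : ∀ t ∈ absInertia (q.adicCompletion ℚ), ∀ x : Fin J → 𝓔, GaloisRep.toLocal q 𝓣 t x = x :=
    fun _ ht x => toLocal_twistModP_apply_of_mem_absInertia (W.torsionGaloisModule (2 : ℤ))
      (fun P : 𝓔 => AddSubgroup.torsionBy.nsmul P) κ J q hunr hqp ht x
  obtain ⟨P₀, hP₀, hker, him⟩ := exists_fixedPoint_of_transposition W hT1 hT2
  obtain ⟨Q, hQ⟩ : ∃ Q : geomTorsion W 2, absGaloisRestrict ℚ (q.adicCompletion ℚ) Fr • Q ≠ Q := by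
    by_contra h; push Not at h; exact hT1 ((mem_ker_galoisRepTorsion_two_iff W _).2 h)
  obtain ⟨φ, hφtr, hφval⟩ := exists_transverse_cocycle_apply_eq_smul_sub_two W κ J q hunr hqp hpl hχI hFr
    hT1 hT2 hJm hFrm ht₀ hgen (Pi.single (⟨0, hJ⟩ : Fin J) Q)
  have hφval' : φ.1 t₀ = Pi.single (⟨0, hJ⟩ : Fin J) P₀ := by
    rw [hφval]
    funext i
    by_cases hi : i = ⟨0, hJ⟩
    · subst hi; rw [Pi.single_eq_same, Pi.single_eq_same]; exact him Q hQ
    · rw [Pi.single_eq_of_ne hi, Pi.single_eq_of_ne hi, smul_zero, sub_zero]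
  obtain ⟨φ', hφ'1, hφ'2⟩ := map_iterate_oneCocycleClass _ S (J - 1 - 0) φ
  have hSit : ∀ (n : ℕ) (v : Fin J → 𝓔), (fun x => S x)^[n] v = (shiftEnd 𝓔 J ^ n) v := by
    intro n v
    induction n with
    | zero => simp
    | succ n ih => rw [Function.iterate_succ_apply', ih, hS, pow_succ', Module.End.mul_apply]
  have hc₀tr : oneCocycleClass _ φ' ∈ DiscreteGaloisModule.transverseSubgroup (GaloisRep.toLocal q 𝓣)
      (CyclotomicField (Ideal.absNorm q.asIdeal) (q.adicCompletion ℚ)) := by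
    rw [← hφ'2]; exact iterate_map_mem_transverseSubgroup _ _ S _ hφtr
  have hc₀val : φ'.1 t₀ = Pi.single (⟨J - 1 - 0, by omega⟩ : Fin J) P₀ := by
    rw [hφ'1, hSit, hφval']
    exact shiftEnd_pow_single_zero' (by omega) P₀
  have hc₀ne : oneCocycleClass _ φ' ≠ 0 := by
    intro h0
    obtain ⟨ev, hev⟩ := exists_evalInertia (GaloisRep.toLocal q 𝓣) hI ht₀
    have h1' : ev (oneCocycleClass _ φ') = Pi.single (⟨J - 1 - 0, by omega⟩ : Fin J) P₀ := by rw [hev, hc₀val]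
    have h2' : ev (oneCocycleClass _ φ') = 0 := by rw [h0]; exact map_zero ev
    have hv : P₀ = 0 := by
      have := congrFun (h1'.symm.trans h2') ⟨J - 1 - 0, by omega⟩
      rwa [Pi.zero_apply, Pi.single_eq_same] at this
    exact hP₀ hv
  obtain ⟨ψ, hψ0, hne⟩ := LocalSplitPrime.exists_unramified_cupProduct_ne_zero_of_transverse_primePow
    (W.torsionGaloisModule (2 : ℤ)) (W.torsionGaloisModule (2 : ℤ))
    (fun P : 𝓔 => AddSubgroup.torsionBy.nsmul P) (fun P : 𝓔 => AddSubgroup.torsionBy.nsmul P) κ J q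
    (StepFour.weilPairingHom_torsionGaloisModule_smul W 2 eW hμ hadd₁ hadd₂ hgal)
    (StepsTwoFour.weilPairingHom_right_nondegenerate W 2 eW hμ hadd₁ hadd₂ hnondeg)
    (StepsTwoFour.weilPairingHom_right_surjective W 2 eW hμ hadd₁ hadd₂ hnondeg)
    hunr hunr hqp hχI inv hperf P hP hc₀tr hc₀ne
  apply hne
  rw [← hφ'2, hu 0 hJ φ ψ hψ0, Finset.sum_range_one, hu0, zero_mul]

end Transposition

/-! ## §3 The ADAPTER: the identity at the local classes of GLOBAL cocycles of `W.modPTwist 2 κ J` -/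
section Adapter

variable (W : WeierstrassCurve ℚ) [W.IsElliptic] (κ : ZpExtension ℚ 2) (J : ℕ)
  (eW : WeierstrassCurve.geomTorsion W (2 : ℤ) → WeierstrassCurve.geomTorsion W (2 : ℤ) → AlgebraicClosure ℚ)
  (hμ : ∀ S T, eW S T ^ 2 = 1) (hadd₁ : ∀ S₁ S₂ T, eW (S₁ + S₂) T = eW S₁ T * eW S₂ T)
  (hadd₂ : ∀ S T₁ T₂, eW S (T₁ + T₂) = eW S T₁ * eW S T₂)
  (halt : ∀ T, eW T T = 1) (hnondeg : ∀ T, (∀ S, eW S T = 1) → T = 0)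
  (hgal : ∀ (σ : absoluteGaloisGroup ℚ) (S T : WeierstrassCurve.geomTorsion W (2 : ℤ)),
    σ • eW S T = eW (σ • S) (σ • T))
  (q : HeightOneSpectrum (𝓞 ℚ)) [Fact (Ideal.absNorm q.asIdeal).Prime]
  [NeZero ((Ideal.absNorm q.asIdeal : ℕ) : q.adicCompletion ℚ)]
  -- the RESTRICTED pairing lives on `absoluteGaloisGroup (Place.Completion (Sum.inr q))` (x10's spelling)
  [LocallyCompactSpace (absoluteGaloisGroup (Place.Completion (Sum.inr q : Place ℚ)))]

-- local notation (proof only): the twist in its `ZpExtension.twistModP` spelling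
local notation3 "𝓣" => ZpExtension.twistModP κ (WeierstrassCurve.torsionGaloisModule W (2 : ℤ))
  (fun P : WeierstrassCurve.geomTorsion W (2 : ℤ) => AddSubgroup.torsionBy.nsmul P) J
include halt hnondeg in
/-- **THE `q`-TERM IDENTITY AT A TRANSPOSITION PRIME (`p = 2`)** — the `hQ` hypothesis of STEP 4
(`StepFour.convCoeff_eq_zero_of_qTermIdentity_modPTwist`, `R := ℤ/2`, `ι := id`, `ι' := ι`, `τq := t₀`, `Frq := Fr`)
for EVERY global cocycle `c` of `𝒯_J(E) = W.modPTwist 2 κ J` (NO transversality) and every global cocycle `Ψc` of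
`W.modPTwist 2 κ.invTwist J` whose localisation at `q` is UNRAMIFIED.  Setting: `E/ℚ` elliptic, a Weil pairing `eW`
on `E[2]` by its six clauses, `ι : μ₂ ↪ ℤ/2`; a prime `q ∤ 2` with `E[2]` unramified, `2 ∣ N(q) − 1`, `χ̄_{N(q)}`
onto on inertia; a Frobenius `Fr` of `ℚ_q` with `ρ̄₂(res Fr)` a TRANSPOSITION (`≠ 1`, square `1`), `res Fr ∈ Γ_m`,
`J ≤ 2^m`; a tame generator `t₀`; a perfect family `inv`.  CONCLUSION: there is `u : ℕ → ℤ/2` with `IsUnit (u 0)`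
and `inv_q(T_q^{J−1−k}(loc_q [c]) ∪ loc_q(T^ε [Ψc])) = Σ_{j≤k} u_j · ι C_{k−j}(c(res t₀), S^ε Ψc(res Fr))` (`k < J`).
[cite: MazurRubin2004, §1.2 and Prop. 1.3.2] [cite: Rubin2000, Lemma 1.4.7 and Thm. 4.5.4] [cite: MilneADT2006, Ch. I, Thm. 2.6] -/
theorem exists_unit_qTermIdentity_transposition
    (ι : DiscreteGaloisModule.MuCarrier ℚ 2 →+ ZMod 2) (hι : Function.Injective ι)
    (hunr : GaloisRep.IsUnramifiedAt q (W.torsionGaloisModule (2 : ℤ)))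
    (hqp : ((2 : ℕ) : 𝓞 ℚ) ∉ q.asIdeal) (hpl : 2 ∣ Ideal.absNorm q.asIdeal - 1)
    (hχI : ∀ u : (ZMod (Ideal.absNorm q.asIdeal))ˣ, ∃ t ∈ absInertia (q.adicCompletion ℚ),
      modPCyclotomicCharacterZMod (q.adicCompletion ℚ) (Ideal.absNorm q.asIdeal) t = u)
    {Fr : absoluteGaloisGroup (q.adicCompletion ℚ)} (hFr : IsAbsArithFrob Fr)
    (hT1 : WeierstrassCurve.galoisRepTorsion W 2 (absGaloisRestrict ℚ (q.adicCompletion ℚ) Fr) ≠ 1)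
    (hT2 : WeierstrassCurve.galoisRepTorsion W 2
      (absGaloisRestrict ℚ (q.adicCompletion ℚ) Fr * absGaloisRestrict ℚ (q.adicCompletion ℚ) Fr) = 1)
    {m : ℕ} (hJm : J ≤ 2 ^ m) (hFrm : absGaloisRestrict ℚ (q.adicCompletion ℚ) Fr ∈ κ.layerSubgroup m)
    {t₀ : absoluteGaloisGroup (q.adicCompletion ℚ)} (ht₀ : t₀ ∈ absInertia (q.adicCompletion ℚ))
    (hgen : ∀ u : (ZMod (Ideal.absNorm q.asIdeal))ˣ,
      u ∈ Subgroup.zpowers (modPCyclotomicCharacterZMod (q.adicCompletion ℚ) (Ideal.absNorm q.asIdeal) t₀))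
    (inv : LocalInvariants ℚ 2) (hperf : inv.IsPerfect) :
    ∃ u : ℕ → ZMod 2, IsUnit (u 0) ∧
      ∀ (c : contOneCocycles (W.modPTwist 2 κ J).toTopRep)
        (Ψc : contOneCocycles (W.modPTwist 2 κ.invTwist J).toTopRep),
        galoisCohomology.localization (W.modPTwist 2 κ.invTwist J) (Sum.inr q) 1
            (oneCocycleClass (W.modPTwist 2 κ.invTwist J).toTopRep Ψc) ∈
          DiscreteGaloisModule.unramifiedSubgroup (GaloisRep.toLocal q (W.modPTwist 2 κ.invTwist J)) 1 →
      ∀ (ε k : ℕ), k < J →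
        inv (Sum.inr q)
          (((κ.twistContPairing (W.torsionGaloisModule (2 : ℤ)) (W.torsionGaloisModule (2 : ℤ))
              (DiscreteGaloisModule.mu ℚ 2)
              (fun P : WeierstrassCurve.geomTorsion W (2 : ℤ) => AddSubgroup.torsionBy.nsmul P)
              (fun P : WeierstrassCurve.geomTorsion W (2 : ℤ) => AddSubgroup.torsionBy.nsmul P) J
              (StepFour.weilPairingHom_torsionGaloisModule_smul W 2 eW hμ hadd₁ hadd₂ hgal)).restrict
              (absGaloisRestrict ℚ (Place.Completion (Sum.inr q : Place ℚ)))).cupProduct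
            ((galoisCohomology.map ((κ.twistModPShift (W.torsionGaloisModule (2 : ℤ))
                (fun P : WeierstrassCurve.geomTorsion W (2 : ℤ) => AddSubgroup.torsionBy.nsmul P) J).restrictField
                (q.adicCompletion ℚ)) 1)^[J - 1 - k]
              (galoisCohomology.localization (W.modPTwist 2 κ J) (Sum.inr q) 1
                (oneCocycleClass (W.modPTwist 2 κ J).toTopRep c)))
            (galoisCohomology.localization (W.modPTwist 2 κ.invTwist J) (Sum.inr q) 1
              ((κ.invTwist.shiftH1 (W.torsionGaloisModule (2 : ℤ))
                  (fun P : WeierstrassCurve.geomTorsion W (2 : ℤ) => AddSubgroup.torsionBy.nsmul P) J)^[ε]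
                (oneCocycleClass (W.modPTwist 2 κ.invTwist J).toTopRep Ψc)))) =
        ∑ j ∈ Finset.range (k + 1), u j * ι (convCoeff (weilPairingHom W 2 eW hμ hadd₁ hadd₂) J (k - j)
          (c.1 (absGaloisRestrict ℚ (q.adicCompletion ℚ) t₀))
          ((shiftEnd (WeierstrassCurve.geomTorsion W (2 : ℤ)) J ^ ε)
            (Ψc.1 (absGaloisRestrict ℚ (q.adicCompletion ℚ) Fr)))) := by
  classical
  haveI : LocallyCompactSpace (absoluteGaloisGroup (q.adicCompletion ℚ)) :=
    ‹LocallyCompactSpace (absoluteGaloisGroup (Place.Completion (Sum.inr q : Place ℚ)))›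
  -- the local identity for the restricted pairing `P` and the restricted shift `S`
  obtain ⟨u, hu0, hu⟩ := exists_unit_inv_cupProduct_eq_sum_convCoeff_transposition W κ J eW hμ hadd₁ hadd₂ q
    halt hnondeg hgal ι hι hunr hqp hpl hχI hFr hT1 hT2 hJm hFrm ht₀ hgen inv hperf
    ((κ.twistContPairing (W.torsionGaloisModule (2 : ℤ)) (W.torsionGaloisModule (2 : ℤ))
      (DiscreteGaloisModule.mu ℚ 2)
      (fun P : WeierstrassCurve.geomTorsion W (2 : ℤ) => AddSubgroup.torsionBy.nsmul P)
      (fun P : WeierstrassCurve.geomTorsion W (2 : ℤ) => AddSubgroup.torsionBy.nsmul P) J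
      (StepFour.weilPairingHom_torsionGaloisModule_smul W 2 eW hμ hadd₁ hadd₂ hgal)).restrict
      (absGaloisRestrict ℚ (Place.Completion (Sum.inr q : Place ℚ))))
    (fun _ _ => rfl)
    ((κ.twistModPShift (W.torsionGaloisModule (2 : ℤ))
      (fun P : WeierstrassCurve.geomTorsion W (2 : ℤ) => AddSubgroup.torsionBy.nsmul P) J).restrictField
      (q.adicCompletion ℚ))
    (fun _ => rfl)
  refine ⟨u, isUnit_iff_ne_zero.2 hu0, fun c Ψc hΨ ε k hk => ?_⟩
  -- the local classes are classes of explicit local cocycles (x10's seams)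
  have e1 := StepFour.localization_oneCocycleClass 𝓣 q c
  have e2 := StepFour.localization_iterate_shiftH1_oneCocycleClass κ.invTwist (W.torsionGaloisModule (2 : ℤ))
    (fun P : WeierstrassCurve.geomTorsion W (2 : ℤ) => AddSubgroup.torsionBy.nsmul P) J q Ψc ε
  -- `ψ := (S^ε Ψc) ∘ res_q` vanishes on inertia (`hΨ`); `φ := c ∘ res_q`
  have h := hu k hk
    (contOneCocycles.pullback (absGaloisRestrict ℚ (q.adicCompletion ℚ)) (X := ContinuousRep.toTopRep 𝓣)
      (Y := (GaloisRep.toLocal q 𝓣).toTopRep)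
      (TopRep.ofHom ⟨ContinuousLinearMap.id ℤ (Fin J → WeierstrassCurve.geomTorsion W (2 : ℤ)), fun _ => rfl⟩) c) _
    (fun t ht => StepFour.localCocycle_iterate_shift_apply_eq_zero_of_mem_absInertia κ.invTwist
      (W.torsionGaloisModule (2 : ℤ))
      (fun P : WeierstrassCurve.geomTorsion W (2 : ℤ) => AddSubgroup.torsionBy.nsmul P) J q hunr hqp Ψc hΨ ε ht)
  rw [StepFour.pullback_absGaloisRestrict_apply, StepFour.localCocycle_iterate_shift_apply, ← e1, ← e2] at h
  exact h

end Adapter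

end Summit.BirchSwinnertonDyer.BirchSwinnertonDyer.Theorems.SteinbergFibreAtTwo

end
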